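import Literature.MathematicalPhysics.KineticTheory.SiteChainLangevinKernel
import Literature.MathematicalPhysics.KineticTheory.LangevinChainConfinedLaSalle
import HarnessLib

/-!
# Site-inhomogeneous confining chains: the undriven flow, its energy identity and its component equations

Topic `Literature/MathematicalPhysics/KineticTheory`, grouping namespace `…KineticTheory.HeatConduction`.
Twin, for the SITE-DEPENDENT chains `SiteChain` of `CellChain.lean` under the hypothesis structure
`SiteChain.UniformlyConfining` (`SiteChainConfined.lean`: `U i, V i ∈ C²` nonnegative, forces dominated
by the energies uniformly in the site, `γ ≥ 0`, every `U i → ∞`), of the deterministic first half of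
`LangevinChainConfinedLaSalle.lean` (which does the same for the homogeneous `OscillatorChain` under
`IsConfining`). For the UNDRIVEN flow `φ_t(x) = drivenFlow (P.langevinDrift N) x 0 t` of the damped
Hamiltonian system `q̇ = p`, `ṗ_i = -∂_iΦ(q) - γ w_i p_i` (`w_i = [i = 0] + [i = N-1]`; the control
system of Cuneo–Eckmann–Hairer–Rey-Bellet 2018, Prop. 3.3 with the ZERO control):

* basic properties (clamped on `(-∞, 0]`, cocycle, continuity in time and initial condition, the
  integral equation, differentiability);
* the energy identity `H(φ_t x) = H(x) - γ ∫₀ᵗ ∑_i w_i p_i(s)² ds`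
  (`UniformlyConfining.hamiltonian_freeFlow_eq`), monotonicity and convergence of the energy, and
  its stationarity along the orbit of a cluster point; for `γ > 0` a stationary energy forces the
  bath momenta to vanish identically (`momentum_eq_zero_of_hamiltonian_const`);
* the component equations `q_i(t) = q_i(0) + ∫₀ᵗ p_i`, `p_i(t) = p_i(0) + ∫₀ᵗ (-∂_iΦ(q) - γ w_i p_i)`
  and their consequences `p_i ≡ 0 ⟹ q_i ≡ q_i(0)`, `p_i ≡ 0 ⟹ ∂_iΦ(q(t)) ≡ 0`.

The sitewise force calculus (closed form of `∂_iΦ`, virial identity) and the rigidity / LaSalle /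
irreducibility / uniqueness half are in `SiteChainLaSalleUniqueness.lean`.

## References

* J. P. LaSalle, *Some extensions of Liapunov's second method*, IRE Trans. Circuit Theory **7**
  (1960) 520–527.
* N. Cuneo, J.-P. Eckmann, M. Hairer, L. Rey-Bellet, *Non-equilibrium steady states for networks of
  oscillators*, Electron. J. Probab. **23** (2018) no. 55, Prop. 3.3 and §5 eq. (5.2).

## Design choices

* Proofs are those of `LangevinChainConfinedLaSalle.lean` with `P.drift ↦ P.langevinDrift`,
  `IsConfining ↦ UniformlyConfining`, `P.U ↦ P.U i`, `P.V ↦ P.V i`; the model-free flow API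
  (`ConfinedDrift.flow_*`, `drivenFlow`) and the generic lemmas `eq_zero_of_intervalIntegral_eq_zero`,
  `OscillatorChain.IsConfining.dissipationDensity_nonneg`, `bathWeight_nonneg` are imported, not copied.
* NOT here: kernels, minorisation, anything probabilistic (next file), anything model-specific.
-/

noncomputable section

open MeasureTheory Filter Topology Set Metric
open scoped NNReal ENNReal ContDiff

namespace Literature.MathematicalPhysics.KineticTheory.HeatConduction

open Literature.MathematicalPhysics.KineticTheory Literature.Analysis.ODE

variable {N : ℕ}

namespace SiteChain

variable (P : SiteChain)

/-! ### The energy derivative along the undriven drift -/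

/-- `DH(y)·Y(y) = -γ ∑_i w_i p_i²` for the Langevin drift of a site-dependent chain without noise
(`C¹` potentials): the Hamiltonian part conserves `H`, the friction dissipates. [folklore] -/
theorem fderiv_hamiltonian_freeDrift (hU : ∀ i, ContDiff ℝ 1 (P.U i)) (hV : ∀ i, ContDiff ℝ 1 (P.V i))
    (y : PhaseSpace N) :
    fderiv ℝ (P.hamiltonian N) y (P.langevinDrift N y) =
      -(P.γ * ∑ i, OscillatorChain.bathWeight N i * y.2 i ^ 2) := by
  rw [P.fderiv_hamiltonian_apply hU hV]
  simp only [langevinDrift]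
  rw [Finset.mul_sum, ← Finset.sum_neg_distrib]
  exact Finset.sum_congr rfl fun i _ => by ring

namespace UniformlyConfining

variable {P}

/-! ### The undriven flow: basic properties -/

/-- For `t ≤ 0` the undriven flow of a site-dependent chain is clamped at `x`. [folklore] -/
theorem freeFlow_of_nonpos (hP : P.UniformlyConfining) (N : ℕ) (x : PhaseSpace N) {t : ℝ} (ht : t ≤ 0) :
    drivenFlow (P.langevinDrift N) x 0 t = x := by
  rw [(hP.confinedDrift N).toConfinedDrift.flow_of_nonpos x continuous_zero ht]
  simp

/-- The undriven flow starts at `x`. [folklore] -/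
theorem freeFlow_zero (hP : P.UniformlyConfining) (N : ℕ) (x : PhaseSpace N) :
    drivenFlow (P.langevinDrift N) x 0 0 = x :=
  hP.freeFlow_of_nonpos N x le_rfl

/-- The zero path lies in the noise subspace of the confined drift. [folklore] -/
theorem zero_path_mem_noise (hP : P.UniformlyConfining) (N : ℕ) (t : ℝ) :
    (0 : ℝ → PhaseSpace N) t ∈ (hP.confinedDrift N).noise :=
  (hP.confinedDrift N).noise.zero_mem

/-- **The cocycle property of the undriven flow**: `φ_{s+t} = φ_t ∘ φ_s` for `s, t ≥ 0`.
[folklore] -/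
theorem freeFlow_add (hP : P.UniformlyConfining) (N : ℕ) (x : PhaseSpace N) {s t : ℝ} (hs : 0 ≤ s)
    (ht : 0 ≤ t) :
    drivenFlow (P.langevinDrift N) x 0 (s + t) =
      drivenFlow (P.langevinDrift N) (drivenFlow (P.langevinDrift N) x 0 s) 0 t := by
  have h := (hP.confinedDrift N).toConfinedDrift.flow_add x continuous_zero (hP.zero_path_mem_noise N) hs ht
  have e : (fun r : ℝ => (0 : ℝ → PhaseSpace N) (s + r) - (0 : ℝ → PhaseSpace N) s) = 0 := by
    funext r; simp
  rw [e] at h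
  exact h

/-- The undriven flow is continuous in time. [folklore] -/
theorem continuous_freeFlow (hP : P.UniformlyConfining) (N : ℕ) (x : PhaseSpace N) :
    Continuous (drivenFlow (P.langevinDrift N) x 0) :=
  (hP.confinedDrift N).toConfinedDrift.continuous_flow x continuous_zero (hP.zero_path_mem_noise N)

/-- The undriven flow is continuous in the initial condition. [folklore] -/
theorem continuous_freeFlow_left (hP : P.UniformlyConfining) (N : ℕ) (t : ℝ) :
    Continuous fun x : PhaseSpace N => drivenFlow (P.langevinDrift N) x 0 t :=
  (hP.confinedDrift N).toConfinedDrift.continuous_flow_left continuous_zero (hP.zero_path_mem_noise N) t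

/-- The undriven flow solves the integral equation `z(t) = x + ∫₀ᵗ Y(z(s)) ds`, `t ≥ 0`.
[folklore] -/
theorem freeFlow_eq_integral (hP : P.UniformlyConfining) (N : ℕ) (x : PhaseSpace N) {t : ℝ} (ht : 0 ≤ t) :
    drivenFlow (P.langevinDrift N) x 0 t =
      x + ∫ s in (0 : ℝ)..t, P.langevinDrift N (drivenFlow (P.langevinDrift N) x 0 s) := by
  have h := (hP.confinedDrift N).toConfinedDrift.isIntegralSolutionOn_flow x continuous_zero
    (hP.zero_path_mem_noise N) t t ⟨ht, le_rfl⟩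
  rw [h]
  simp

/-- The Langevin drift of a uniformly confining chain is continuous. [folklore] -/
theorem continuous_langevinDrift (hP : P.UniformlyConfining) (N : ℕ) : Continuous (P.langevinDrift N) :=
  (P.contDiff_one_langevinDrift hP.contDiff_U hP.contDiff_V N).continuous

/-- **The undriven flow is a classical solution**: `φ'(t) = Y(φ(t))` for `t > 0`. [folklore] -/
theorem hasDerivAt_freeFlow (hP : P.UniformlyConfining) (N : ℕ) (x : PhaseSpace N) {t : ℝ} (ht : 0 < t) :
    HasDerivAt (drivenFlow (P.langevinDrift N) x 0)
      (P.langevinDrift N (drivenFlow (P.langevinDrift N) x 0 t)) t := by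
  set z := drivenFlow (P.langevinDrift N) x 0 with hz
  have hYz : Continuous fun s => P.langevinDrift N (z s) :=
    (hP.continuous_langevinDrift N).comp (hP.continuous_freeFlow N x)
  set g : ℝ → PhaseSpace N := fun s => x + ∫ r in (0 : ℝ)..s, P.langevinDrift N (z r) with hg
  have hgd : HasDerivAt g (P.langevinDrift N (z t)) t := by
    have h1 := intervalIntegral.integral_hasDerivAt_right (hYz.intervalIntegrable 0 t)
      (hYz.stronglyMeasurableAtFilter volume (𝓝 t)) hYz.continuousAt
    exact h1.const_add x
  refine hgd.congr_of_eventuallyEq ?_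
  filter_upwards [Icc_mem_nhds ht (lt_add_one t)] with s hs
  exact hP.freeFlow_eq_integral N x hs.1

/-! ### The energy identity and its consequences -/

/-- **The energy derivative along the undriven flow**: `(H∘φ)'(t) = -γ ∑ w_i p_i(t)²` (`t > 0`).
[cite: CuneoEckmannHairerReyBellet2018, §5 eq. (5.2)] -/
theorem hasDerivAt_hamiltonian_freeFlow (hP : P.UniformlyConfining) (N : ℕ) (x : PhaseSpace N) {t : ℝ}
    (ht : 0 < t) :
    HasDerivAt (fun s => P.hamiltonian N (drivenFlow (P.langevinDrift N) x 0 s))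
      (-(P.γ * ∑ i, OscillatorChain.bathWeight N i * (drivenFlow (P.langevinDrift N) x 0 t).2 i ^ 2)) t := by
  have hH := hP.differentiable_hamiltonian N
  have hU1 : ∀ i, ContDiff ℝ 1 (P.U i) := fun i => (hP.contDiff_U i).of_le (by norm_num)
  have hV1 : ∀ i, ContDiff ℝ 1 (P.V i) := fun i => (hP.contDiff_V i).of_le (by norm_num)
  have h := ((hH _).hasFDerivAt).comp_hasDerivAt t (hP.hasDerivAt_freeFlow N x ht)
  rw [P.fderiv_hamiltonian_freeDrift hU1 hV1] at h
  exact h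

/-- **The energy identity of the undriven flow**: `H(φ_t x) = H(x) - γ ∫₀ᵗ ∑_i w_i p_i(s)² ds`
(`t ≥ 0`). [cite: CuneoEckmannHairerReyBellet2018, §5 eq. (5.2)] -/
theorem hamiltonian_freeFlow_eq (hP : P.UniformlyConfining) (N : ℕ) (x : PhaseSpace N) {t : ℝ} (ht : 0 ≤ t) :
    P.hamiltonian N (drivenFlow (P.langevinDrift N) x 0 t) = P.hamiltonian N x -
      P.γ * ∫ s in (0 : ℝ)..t,
        ∑ i, OscillatorChain.bathWeight N i * (drivenFlow (P.langevinDrift N) x 0 s).2 i ^ 2 := by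
  set z := drivenFlow (P.langevinDrift N) x 0 with hz
  have hzc : Continuous z := hP.continuous_freeFlow N x
  have hDc : Continuous fun s => ∑ i, OscillatorChain.bathWeight N i * (z s).2 i ^ 2 :=
    continuous_finsetSum _ fun i _ =>
      continuous_const.mul (((continuous_apply i).comp (continuous_snd.comp hzc)).pow 2)
  have hf'c : Continuous fun s => -(P.γ * ∑ i, OscillatorChain.bathWeight N i * (z s).2 i ^ 2) :=
    (continuous_const.mul hDc).neg
  have hHc : Continuous fun s => P.hamiltonian N (z s) :=
    (P.continuous_hamiltonian N (fun i => (hP.contDiff_U i).continuous)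
      (fun i => (hP.contDiff_V i).continuous)).comp hzc
  have hftc := intervalIntegral.integral_eq_sub_of_hasDeriv_right_of_le ht hHc.continuousOn
    (fun s hs => (hP.hasDerivAt_hamiltonian_freeFlow N x hs.1).hasDerivWithinAt)
    (hf'c.intervalIntegrable 0 t)
  have hz0 : z 0 = x := hP.freeFlow_zero N x
  rw [intervalIntegral.integral_neg, intervalIntegral.integral_const_mul, hz0] at hftc
  linarith

/-- The energy does not increase along the undriven flow: `H(φ_t x) ≤ H(x)` (all `t`). [folklore] -/
theorem hamiltonian_freeFlow_le (hP : P.UniformlyConfining) (N : ℕ) (x : PhaseSpace N) (t : ℝ) :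
    P.hamiltonian N (drivenFlow (P.langevinDrift N) x 0 t) ≤ P.hamiltonian N x := by
  rcases le_or_gt t 0 with ht | ht
  · rw [hP.freeFlow_of_nonpos N x ht]
  · rw [hP.hamiltonian_freeFlow_eq N x ht.le]
    have h : 0 ≤ ∫ s in (0 : ℝ)..t,
        ∑ i, OscillatorChain.bathWeight N i * (drivenFlow (P.langevinDrift N) x 0 s).2 i ^ 2 :=
      intervalIntegral.integral_nonneg ht.le fun s _ =>
        OscillatorChain.IsConfining.dissipationDensity_nonneg N _
    nlinarith [hP.γ_nonneg]

/-- The energy along the undriven flow is nonincreasing in time. [folklore] -/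
theorem antitone_hamiltonian_freeFlow (hP : P.UniformlyConfining) (N : ℕ) (x : PhaseSpace N) :
    Antitone fun t => P.hamiltonian N (drivenFlow (P.langevinDrift N) x 0 t) := by
  intro a b hab
  simp only
  rcases le_or_gt a 0 with ha | ha
  · rw [hP.freeFlow_of_nonpos N x ha]
    exact hP.hamiltonian_freeFlow_le N x b
  · have h := hP.freeFlow_add N x ha.le (sub_nonneg.2 hab)
    rw [add_sub_cancel] at h
    rw [h]
    exact hP.hamiltonian_freeFlow_le N _ _

/-- The energy along the undriven flow converges as `t → ∞`. [folklore] -/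
theorem exists_tendsto_hamiltonian_freeFlow (hP : P.UniformlyConfining) (N : ℕ) (x : PhaseSpace N) :
    ∃ Einf : ℝ,
      Tendsto (fun t => P.hamiltonian N (drivenFlow (P.langevinDrift N) x 0 t)) atTop (𝓝 Einf) := by
  refine ⟨_, tendsto_atTop_ciInf (hP.antitone_hamiltonian_freeFlow N x) ⟨0, ?_⟩⟩
  rintro _ ⟨t, rfl⟩
  exact hP.hamiltonian_nonneg N _

/-- The orbit of the undriven flow stays in the compact sublevel set `{H ≤ H(x)}`. [folklore] -/
theorem freeFlow_mem_sublevel (hP : P.UniformlyConfining) (N : ℕ) (x : PhaseSpace N) (t : ℝ) :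
    drivenFlow (P.langevinDrift N) x 0 t ∈
      {y : PhaseSpace N | P.hamiltonian N y ≤ P.hamiltonian N x} :=
  hP.hamiltonian_freeFlow_le N x t

/-- **At a cluster point of the orbit the energy is stationary**: if `w` is a cluster point of
`t ↦ φ_t(x)` at `+∞` then `H(φ_s w) = H(w)` for every `s ≥ 0`. [folklore] -/
theorem hamiltonian_freeFlow_eq_of_mapClusterPt (hP : P.UniformlyConfining) (N : ℕ) (x : PhaseSpace N)
    {w : PhaseSpace N} (hw : MapClusterPt w atTop (drivenFlow (P.langevinDrift N) x 0)) {s : ℝ}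
    (hs : 0 ≤ s) :
    P.hamiltonian N (drivenFlow (P.langevinDrift N) w 0 s) = P.hamiltonian N w := by
  obtain ⟨Einf, hE⟩ := hP.exists_tendsto_hamiltonian_freeFlow N x
  have hHc := P.continuous_hamiltonian N (fun i => (hP.contDiff_U i).continuous)
    (fun i => (hP.contDiff_V i).continuous)
  have hcont : ∀ r : ℝ, Continuous fun y => P.hamiltonian N (drivenFlow (P.langevinDrift N) y 0 r) :=
    fun r => hHc.comp (hP.continuous_freeFlow_left N r)
  have hval : ∀ r : ℝ, 0 ≤ r → P.hamiltonian N (drivenFlow (P.langevinDrift N) w 0 r) = Einf := by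
    intro r hr
    have hcl : MapClusterPt (P.hamiltonian N (drivenFlow (P.langevinDrift N) w 0 r)) atTop
        ((fun y => P.hamiltonian N (drivenFlow (P.langevinDrift N) y 0 r)) ∘
          drivenFlow (P.langevinDrift N) x 0) :=
      MapClusterPt.continuousAt_comp
        (f := fun y => P.hamiltonian N (drivenFlow (P.langevinDrift N) y 0 r))
        (hcont r).continuousAt hw
    have heq : ((fun y => P.hamiltonian N (drivenFlow (P.langevinDrift N) y 0 r)) ∘
        drivenFlow (P.langevinDrift N) x 0)
        =ᶠ[atTop] fun t => P.hamiltonian N (drivenFlow (P.langevinDrift N) x 0 (t + r)) := by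
      filter_upwards [eventually_ge_atTop 0] with t ht
      simp only [Function.comp_apply]
      rw [hP.freeFlow_add N x ht hr]
    have hlim : Tendsto (fun t => P.hamiltonian N (drivenFlow (P.langevinDrift N) x 0 (t + r))) atTop
        (𝓝 Einf) :=
      hE.comp (tendsto_atTop_add_const_right atTop r tendsto_id)
    exact t2_iff_nhds.1 inferInstance (((hcl.congrFun heq).clusterPt).mono hlim)
  have h0 := hval 0 le_rfl
  rw [hP.freeFlow_zero N w] at h0
  rw [hval s hs, h0]

/-- **If the energy is stationary along the undriven flow and `γ > 0`, the bath momenta vanish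
identically**: `p_i(s) = 0` for all `s ≥ 0` at every site with `w_i ≠ 0`. [folklore] -/
theorem momentum_eq_zero_of_hamiltonian_const (hP : P.UniformlyConfining) (N : ℕ) (hγ : 0 < P.γ)
    (w : PhaseSpace N)
    (h : ∀ s, 0 ≤ s → P.hamiltonian N (drivenFlow (P.langevinDrift N) w 0 s) = P.hamiltonian N w)
    (i : Fin N) (hi : OscillatorChain.bathWeight N i ≠ 0) :
    ∀ s, 0 ≤ s → (drivenFlow (P.langevinDrift N) w 0 s).2 i = 0 := by
  set D : ℝ → ℝ := fun r =>
    ∑ j, OscillatorChain.bathWeight N j * (drivenFlow (P.langevinDrift N) w 0 r).2 j ^ 2 with hD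
  have hzc := hP.continuous_freeFlow N w
  have hDc : Continuous D :=
    continuous_finsetSum _ fun j _ =>
      continuous_const.mul (((continuous_apply j).comp (continuous_snd.comp hzc)).pow 2)
  have hint : ∀ t, 0 ≤ t → ∫ s in (0 : ℝ)..t, D s = 0 := by
    intro t ht
    have h1 := hP.hamiltonian_freeFlow_eq N w ht
    rw [h t ht] at h1
    have h2 : P.γ * ∫ s in (0 : ℝ)..t, D s = 0 := by linarith
    exact (mul_eq_zero.1 h2).resolve_left hγ.ne'
  have hD0 := eq_zero_of_intervalIntegral_eq_zero hDc hint
  intro s hs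
  have hterm := (Finset.sum_eq_zero_iff_of_nonneg fun j _ =>
    mul_nonneg (bathWeight_nonneg N j) (sq_nonneg _)).1 (hD0 s hs) i (Finset.mem_univ i)
  rcases mul_eq_zero.1 hterm with h3 | h3
  · exact absurd h3 hi
  · exact pow_eq_zero_iff (n := 2) two_ne_zero |>.1 h3

/-! ### The component equations of the undriven flow -/

/-- The drift in closed form: `Y(q, p) = (p, -∂Φ(q) - γ w p)`. [folklore] -/
theorem langevinDrift_apply (hP : P.UniformlyConfining) (N : ℕ) (x : PhaseSpace N) :
    P.langevinDrift N x =
      (x.2, fun i => -P.dPotential N i x.1 - P.γ * OscillatorChain.bathWeight N i * x.2 i) := by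
  rw [P.langevinDrift_eq hP.differentiable_U hP.differentiable_V N]

/-- **Position components of the integral equation**: `q_i(t) = q_i(0) + ∫₀ᵗ p_i`. [folklore] -/
theorem freeFlow_fst_eq (hP : P.UniformlyConfining) (N : ℕ) (x : PhaseSpace N) (i : Fin N) {t : ℝ}
    (ht : 0 ≤ t) :
    (drivenFlow (P.langevinDrift N) x 0 t).1 i =
      x.1 i + ∫ s in (0 : ℝ)..t, (drivenFlow (P.langevinDrift N) x 0 s).2 i := by
  set z := drivenFlow (P.langevinDrift N) x 0 with hz
  have hF : IntervalIntegrable (fun s => P.langevinDrift N (z s)) volume 0 t :=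
    ((hP.continuous_langevinDrift N).comp (hP.continuous_freeFlow N x)).intervalIntegrable 0 t
  have h := hP.freeFlow_eq_integral N x ht
  have hcomp := ((ContinuousLinearMap.proj (R := ℝ) i).comp
    (ContinuousLinearMap.fst ℝ (Fin N → ℝ) (Fin N → ℝ))).intervalIntegral_comp_comm hF
  have h1 : (z t).1 i = x.1 i + ((∫ s in (0 : ℝ)..t, P.langevinDrift N (z s)).1) i := by
    show (drivenFlow (P.langevinDrift N) x 0 t).1 i = _
    rw [h]
    rfl
  rw [h1]
  congr 1
  simp only [ContinuousLinearMap.coe_comp, ContinuousLinearMap.coe_fst', Function.comp_apply,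
    ContinuousLinearMap.proj_apply] at hcomp
  rw [← hcomp]
  refine intervalIntegral.integral_congr fun s _ => ?_
  rw [hP.langevinDrift_apply N]

/-- **Momentum components of the integral equation**:
`p_i(t) = p_i(0) + ∫₀ᵗ (-∂_iΦ(q) - γ w_i p_i)`. [folklore] -/
theorem freeFlow_snd_eq (hP : P.UniformlyConfining) (N : ℕ) (x : PhaseSpace N) (i : Fin N) {t : ℝ}
    (ht : 0 ≤ t) :
    (drivenFlow (P.langevinDrift N) x 0 t).2 i =
      x.2 i + ∫ s in (0 : ℝ)..t,
        (-P.dPotential N i (drivenFlow (P.langevinDrift N) x 0 s).1 -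
          P.γ * OscillatorChain.bathWeight N i * (drivenFlow (P.langevinDrift N) x 0 s).2 i) := by
  set z := drivenFlow (P.langevinDrift N) x 0 with hz
  have hF : IntervalIntegrable (fun s => P.langevinDrift N (z s)) volume 0 t :=
    ((hP.continuous_langevinDrift N).comp (hP.continuous_freeFlow N x)).intervalIntegrable 0 t
  have h := hP.freeFlow_eq_integral N x ht
  have hcomp := ((ContinuousLinearMap.proj (R := ℝ) i).comp
    (ContinuousLinearMap.snd ℝ (Fin N → ℝ) (Fin N → ℝ))).intervalIntegral_comp_comm hF
  have h1 : (z t).2 i = x.2 i + ((∫ s in (0 : ℝ)..t, P.langevinDrift N (z s)).2) i := by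
    show (drivenFlow (P.langevinDrift N) x 0 t).2 i = _
    rw [h]
    rfl
  rw [h1]
  congr 1
  simp only [ContinuousLinearMap.coe_comp, ContinuousLinearMap.coe_snd', Function.comp_apply,
    ContinuousLinearMap.proj_apply] at hcomp
  rw [← hcomp]
  refine intervalIntegral.integral_congr fun s _ => ?_
  rw [hP.langevinDrift_apply N]

/-- Along the undriven flow, a momentum that vanishes identically freezes its position.
[folklore] -/
theorem freeFlow_fst_const_of_snd_eq_zero (hP : P.UniformlyConfining) (N : ℕ) (x : PhaseSpace N)
    (i : Fin N) (hp : ∀ t, 0 ≤ t → (drivenFlow (P.langevinDrift N) x 0 t).2 i = 0) :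
    ∀ t, 0 ≤ t → (drivenFlow (P.langevinDrift N) x 0 t).1 i = x.1 i := by
  intro t ht
  rw [hP.freeFlow_fst_eq N x i ht]
  have : ∫ s in (0 : ℝ)..t, (drivenFlow (P.langevinDrift N) x 0 s).2 i = ∫ _ in (0 : ℝ)..t, (0 : ℝ) := by
    refine intervalIntegral.integral_congr fun s hs => ?_
    rw [uIcc_of_le ht] at hs
    exact hp s hs.1
  rw [this]
  simp

/-- Along the undriven flow, a momentum that vanishes identically makes the force on its site
vanish: `p_i ≡ 0 ⟹ ∂_iΦ(q(t)) = 0`. [folklore] -/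
theorem dPotential_eq_zero_of_snd_eq_zero (hP : P.UniformlyConfining) (N : ℕ) (x : PhaseSpace N)
    (i : Fin N) (hp : ∀ t, 0 ≤ t → (drivenFlow (P.langevinDrift N) x 0 t).2 i = 0) :
    ∀ t, 0 ≤ t → P.dPotential N i (drivenFlow (P.langevinDrift N) x 0 t).1 = 0 := by
  have hzc := hP.continuous_freeFlow N x
  have h21 : (2 : WithTop ℕ∞) = 1 + 1 := by norm_num
  have hU1 : ∀ j, ContDiff ℝ (1 + 1) (P.U j) := fun j => h21 ▸ hP.contDiff_U j
  have hV1 : ∀ j, ContDiff ℝ (1 + 1) (P.V j) := fun j => h21 ▸ hP.contDiff_V j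
  have hFc : Continuous fun s => P.dPotential N i (drivenFlow (P.langevinDrift N) x 0 s).1 :=
    (P.contDiff_dPotential_of_succ hU1 hV1 N i).continuous.comp (continuous_fst.comp hzc)
  have hx0 : x.2 i = 0 := by
    have h0 := hp 0 le_rfl
    rwa [hP.freeFlow_zero N x] at h0
  refine eq_zero_of_intervalIntegral_eq_zero hFc fun t ht => ?_
  have h1 := hP.freeFlow_snd_eq N x i ht
  rw [hp t ht, hx0] at h1
  have h2 : ∫ s in (0 : ℝ)..t, (-P.dPotential N i (drivenFlow (P.langevinDrift N) x 0 s).1 -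
      P.γ * OscillatorChain.bathWeight N i * (drivenFlow (P.langevinDrift N) x 0 s).2 i) =
      ∫ s in (0 : ℝ)..t, -P.dPotential N i (drivenFlow (P.langevinDrift N) x 0 s).1 := by
    refine intervalIntegral.integral_congr fun s hs => ?_
    rw [uIcc_of_le ht] at hs
    rw [hp s hs.1]
    ring
  rw [h2, intervalIntegral.integral_neg] at h1
  linarith

end UniformlyConfining

end SiteChain

end Literature.MathematicalPhysics.KineticTheory.HeatConduction
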